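import Summits.Ventures.PercRepro.Night2GoodTwoFaces

/-!
# night-2: a lossy big set of cell `(2, 1)` has exactly three coloops off `K`

For a big thin pair `(B, z)` with `loss B z ≠ 0`, the set `Q′ = insert z B ∖ K` has rank `5`, at least six points,
and exactly three coloops: fewer than three leave `L1 ≤ 7/12 < capS` (`loss_eq_zero_of_card_coloops_le_two`);
`j ≥ 4` coloops leave `|Q′| − j ≥ 2` points of rank `5 − j ≤ 1` (simple), and `j = 5` a single point of rank `0`
(loopless).  Every coloop of `Q′` is therefore one of the three thin faces of `Q` — there is no "dark" coloop whose
face fails the member condition — which is what the good-point and distance-2 analyses of `dshGT2` rest on.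
-/

namespace PercRepro.Shadow

open PercRepro.ThmH PercRepro.PerFlat

variable {α : Type*} [DecidableEq α] {M : Matroid α} [M.Finite] {G : Finset α}

omit [DecidableEq α] in
/-- A loopless point has rank one. -/
theorem rkN_singleton_of_indep {e : α} (he : M.Indep {e}) : rkN M {e} = 1 := by
  unfold rkN
  rw [Finset.coe_singleton, he.eRk_eq_encard, Set.encard_singleton]
  rfl

/-- A thin member lies in `G`. -/
theorem subset_G_of_mem_thinMembers {q : ℕ} {B : Finset α} (hB : B ∈ thinMembers M q G) : B ⊆ G := by
  have h := (mem_thinMembers.1 hB).1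
  simp only [membersIn, Finset.mem_filter] at h
  have hBg : B ⊆ gr M := (mem_Uq.1 h.1).1
  exact fun x hx => h.2 (subset_clF_of_subset_gr hBg hx)

/-- **A lossy big set has exactly three coloops off `K`.** -/
theorem card_coloops_eq_three_of_loss_ne_zero (hG : G ∈ flatsQ M (5 + 1)) (hd : (gr M \ G).card = 2)
    (hk : kColoops M G = 1) (hs : ∀ e ∈ gr M, ∀ f ∈ gr M, e ≠ f → rkN M {e, f} = 2)
    (hl : ∀ e ∈ gr M, M.Indep {e}) {B : Finset α} (hB : B ∈ thinMembers M 5 G)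
    (hbig : 5 ≤ (B \ coloops M G).card) {z : α} (hz : z ∈ G \ clF M B) (h : loss M 5 G B z ≠ 0) :
    (coloops M (insert z B \ coloops M G)).card = 3 := by
  have hd' : (gr M \ G).card ≤ 5 := by omega
  have hGg : G ⊆ gr M := (mem_flatsQ.1 hG).1
  have hKB : coloops M G ⊆ B := coloops_subset_of_mem_thinMembers hG hd' hB
  have hBG : B ⊆ G := subset_G_of_mem_thinMembers hB
  rw [Finset.mem_sdiff] at hz
  have hzB : z ∉ B := fun hzB => hz.2 (subset_clF_of_subset_gr (hBG.trans hGg) hzB)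
  have hzK : z ∉ coloops M G := fun hzK => hzB (hKB hzK)
  have hQG : insert z B ⊆ G := Finset.insert_subset hz.1 hBG
  have hKQ : coloops M G ⊆ insert z B := hKB.trans (Finset.subset_insert _ _)
  -- rank of `Q′ = insert z B ∖ K` is `5`
  have hrQ : rkN M (insert z B) = 6 := by
    rw [rkN_insert_of_notMem_clF (hGg hz.1) hz.2, rkN_eq_five_of_mem_thinMembers hB]
  have hrQs : rkN M (insert z B \ coloops M G) = 5 := by
    have := rkN_eq_rkN_sdiff_add_one hG hk (S := insert z B) hQG (Finset.Subset.refl _) hKQ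
    omega
  -- `Q′` has at least six points
  have hQeq : insert z B \ coloops M G = insert z (B \ coloops M G) := Finset.insert_sdiff_of_notMem _ hzK
  have hcardQ : 6 ≤ (insert z B \ coloops M G).card := by
    rw [hQeq, Finset.card_insert_of_notMem (fun hzB' => hzB (Finset.mem_sdiff.1 hzB').1)]
    omega
  have hQg : insert z B \ coloops M G ⊆ gr M := (Finset.sdiff_subset.trans hQG).trans hGg
  have hCQ : coloops M (insert z B \ coloops M G) ⊆ insert z B \ coloops M G :=
    fun w hw => (mem_coloops.1 hw).1
  have hrk := rkN_sdiff_add_card_of_subset_coloops (M := M) hQg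
    (Finset.Subset.refl (coloops M (insert z B \ coloops M G)))
  rw [hrQs] at hrk
  have hcsd := Finset.card_sdiff_add_card_eq_card hCQ
  by_contra hne
  rcases Nat.lt_or_gt_of_ne hne with hlt | hgt
  · exact h (loss_eq_zero_of_card_coloops_le_two hG hd hk hQG (by omega))
  · -- `j ≥ 4`: the non-coloops have rank `≤ 1`, hence at most one point
    have hr1 : rkN M ((insert z B \ coloops M G) \ coloops M (insert z B \ coloops M G)) ≤ 1 := by omega
    have hc1 := card_le_one_of_rkN_le_one hs (Finset.sdiff_subset.trans hQg) hr1
    have hc1' : ((insert z B \ coloops M G) \ coloops M (insert z B \ coloops M G)).card = 1 := by omega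
    have hr0 : rkN M ((insert z B \ coloops M G) \ coloops M (insert z B \ coloops M G)) = 0 := by omega
    obtain ⟨e, he⟩ := Finset.card_eq_one.1 hc1'
    have heg : e ∈ gr M := (Finset.sdiff_subset.trans hQg) (he ▸ Finset.mem_singleton_self e)
    rw [he, rkN_singleton_of_indep (hl e heg)] at hr0
    exact absurd hr0 one_ne_zero

end PercRepro.Shadow
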